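import Mathlib
import HarnessLib
import Summits.NavierStokesRegularity.NavierStokesRegularity.Theses.SubcriticalEnvelope
import Summits.NavierStokesRegularity.NavierStokesRegularity.Theses.SubOnsagerCeiling
import Summits.NavierStokesRegularity.NavierStokesRegularity.Theorems.SubcriticalEnvelopeForwardSourceTailEnvelopeKPOfCeiling
import Summits.NavierStokesRegularity.NavierStokesRegularity.Theorems.SubcriticalEnvelopeForwardSourceTailEnvelopeKPOfBlockWake
import Summits.NavierStokesRegularity.NavierStokesRegularity.Theorems.SubcriticalEnvelopeForwardSourceTailEnvelopeKPPermLow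
import Summits.NavierStokesRegularity.NavierStokesRegularity.Theorems.SubcriticalEnvelopeForwardSourceTailEnvelopeKPFan

set_option linter.unusedVariables false
set_option linter.dupNamespace false

/-! # LEAD skeleton «via-ceiling» for the crux `SubcriticalEnvelope.ForwardSourceTailEnvelopeKP`
(stmt-NavierStokesRegularity-27130) — LEAD prover-ns-senv-p1 (registered by g2 2026-08-28 09:46Z,
sha e66513908ec5; tree mirror + rung documentation by g3).  MODEL LATTICE ONLY (rung TL-M2Break); no
summit is proved by a line; nothing here bears on NS regularity.

Shape: ONE stub = the sibling crux `SubOnsagerCeiling.ForwardTailCeilingKP` (stmt-27057) BY NAME; the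
composition `ForwardSourceTailEnvelopeKP_of` is the landed glue
`Theorems.forwardSourceTailEnvelopeKP_of_forwardTailCeilingKP` (p622470: per table, θ > 1/2 ⇒ η = 2θ − 1,
window constant C·E₀ uniform in ν; εs = 1).  Redundant second door (parked): 26999 `KPBlockWake` ⇒ 27130
(`Theorems.forwardSourceTailEnvelopeKP_of_kpBlockWake`, p624862).  No structural hour is spent on 27130
itself: its fate is 27057's (LEAD SOC, skeleton «kp-shell-barrier» v4: `stub_kpCeilingLargeRatio` /
`stub_kpCeilingSmallRatio`, KEY-NS #146: large ratio first, via exit-graph K41 slaving).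

RUNGS (sorry-free, BC5 witnesses of weakness of the ONE stub; sibling census on 27130, not folded onto
27057's skeleton): the inner clause of 27130 / `ShellBarrierAt` holds on
{uniform KP permutation networks} ∪ {uniform KP fan networks} × ε₀ ∈ [9/16, 1] (θ = 101/200, D = 100),
by exact reduction to LEAD SOC's chain RUNGS 2–4 (`kpPermLowWide_shellBarrierAt` p643496,
`kpFanWide_shellBarrierAt` p643534).  The crux's own quantifier (∃ εs ∀ ε₀ ≤ εs) lives in the SMALL-ratio
regime, where no rung exists (census v3 §3). -/

open Summit.NavierStokesRegularity.NavierStokesRegularity.Theses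
open Summit.NavierStokesRegularity.NavierStokesRegularity.Theorems
open Summit.NavierStokesRegularity.NavierStokesRegularity.Theorems.SubOnsagerCeiling

namespace Summit.NavierStokesRegularity.NavierStokesRegularity.Cruxes.ForwardSourceTailEnvelopeKP.ViaCeiling

/-- Registered stub statement (THE stub): the sibling crux `ForwardTailCeilingKP` (stmt-27057) by name. -/
def Sig.stub_forwardTailCeilingKP : Prop := SubOnsagerCeiling.ForwardTailCeilingKP

theorem stub_forwardTailCeilingKP : Sig.stub_forwardTailCeilingKP := by
  sorry

/-- RUNG (landed p643496): uniform KP permutation networks satisfy the shell barrier at every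
`ε₀ ∈ [9/16, 1]` (every `σ`, every orbit-constant `c`). -/
theorem rung_kpPermLowWide {σ : Equiv.Perm (Fin 4)} {c : Fin 4 → ℝ} (hcyc : ∀ a, c (σ a) = c a) :
    ∀ R : ℝ, ∀ ε₀ : ℝ, (9 : ℝ) / 16 ≤ ε₀ → ε₀ ≤ 1 → ShellBarrierAt R ε₀ (kpPermTable σ c) :=
  kpPermLowWide_shellBarrierAt hcyc

/-- RUNG (landed p643534): uniform KP fan networks satisfy the shell barrier at every `ε₀ ∈ [9/16, 1]`
(every weight vector `w`). -/
theorem rung_kpFanWide (w : Fin 4 → ℝ) :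
    ∀ R : ℝ, ∀ ε₀ : ℝ, (9 : ℝ) / 16 ≤ ε₀ → ε₀ ≤ 1 → ShellBarrierAt R ε₀ (kpFanTable w) :=
  kpFanWide_shellBarrierAt w

/-- Second door (parked crux 26999): `KPBlockWake ⇒ ForwardSourceTailEnvelopeKP` (landed p624862). -/
theorem of_kpBlockWake (h : OrthantWake.KPBlockWake) : SubcriticalEnvelope.ForwardSourceTailEnvelopeKP :=
  forwardSourceTailEnvelopeKP_of_kpBlockWake h

/-- Composition: the ONE stub gives the crux BY NAME (landed glue p622470). -/
theorem ForwardSourceTailEnvelopeKP_of :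
    Sig.stub_forwardTailCeilingKP →
      Summit.NavierStokesRegularity.NavierStokesRegularity.Theses.SubcriticalEnvelope.ForwardSourceTailEnvelopeKP :=
  fun h => forwardSourceTailEnvelopeKP_of_forwardTailCeilingKP h

end Summit.NavierStokesRegularity.NavierStokesRegularity.Cruxes.ForwardSourceTailEnvelopeKP.ViaCeiling
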